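import Literature.Probability.RandomPlanarGeometry.SAWCountZdSymbolBlockStatistics
import HarnessLib

/-!
# TWO OUTER POSITIONS TOGETHER, FOR EVERY LAYER: `N_same = Σ_t 2^t C(n−2,t)·(2·T(n−2−t,k) + S(n−t,k))` in (A, B, ρ) coordinates

Topic `Literature/Probability/RandomPlanarGeometry` (the «SYMBOL POLYNOMIALITY» programme; all-layer infrastructure on `SAWCountZdSymbolBlockStatistics.lean` (a-p1 g27:
`card_twoParts_filter_mem_blockOf_eq`, `sameBlockT`, `card_disjPairs_filter_pair/_fst`, `disjPairs_filter_avoid`), `SAWCountZdSymbolLowestCorner.lean` (`card_disjPairs_eq`),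
`SAWCountZdSymbolTwoPartsRecurrence.lean` (`assocStirling`, `card_twoParts_eq_assocStirling`), `SAWCountZdSymbolSecondLowerCount.lean` (a-p1 g26: `abData`, `outerPos`)).

PRINTED CONTEXT (locators only). Charalambides (2018) Ch. 2 Exercise 32 (associated Stirling numbers `T(n,k)`); Madras–Slade (1993) Definition 1.2.4.

THE THEOREM. For two outer positions `o ≠ o'` of a one-block window on `m` letters (`n = m − 4` outer positions, `k = m − j − 2` further blocks) the (A, B, ρ) data with `o, o'`
«in one block» — both carrying the block axis `x` (`o, o' ∈ A`), both carrying `y` (`∈ B`), or both in one block of `ρ` — number ★★ `card_abData_filter_fst_pair_eq_sum` /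
`_snd_pair_eq_sum`: **`Σ_{t ≤ n−2} 2^t C(n−2,t) T(n−2−t,k)`** each, and ★★ `card_abData_filter_sameRho_eq_sum`: **`Σ_{t ≤ n−2} 2^t C(n−2,t)
S(n−t,k)`** (`S = sameBlockT`: two points in
one block of a `twoParts`); together ★★★ `card_abData_filter_same_eq_sum`: **`N_same(m,j) = Σ_{t ≤ m−6} 2^t C(m−6,t)·(2·T(m−6−t,k) + S(m−4−t,k))`** — the last input of the
SECOND-LOWEST-CORNER formula of FINDING-ZD-SYMBOL-POLYNOMIALITY §21 (v) (15 census retrodictions; blind HITs P-BV-6/7 at `j = 9`). At `m = 2j − 1` (`k = 1…`) it is car M's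
`K_j = C(2j−7,3)(2j−11)‼ + 3(2j−7)(2j−9)‼` (`card_abData_filter_same_values`: `3, 10, 55, 420` for `j = 4…7`).

THIS FILE (lane «pcv-sawmu», a-p1 g27; all PROVED, standard axioms): `filter_abData_eq_sigma` (private), ★★ `card_abData_filter_snd_pair_eq_sum`, ★★ `card_abData_filter_fst_pair_eq_sum`,
★★ `card_abData_filter_sameRho_eq_sum`, ★★★ `card_abData_filter_same_eq_sum`, `card_abData_filter_same_values`.
[cite: Charalambides2018, Ch. 2 Exercise 32 (associated Stirling numbers of the second kind)] [cite: MadrasSlade1993, Definition 1.2.4]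

Provenance: lane «pcv-sawmu», a-p1 g27 (2026-08-28).
-/

open Finset
open scoped BigOperators
open Literature.Probability.LatticeModels
open Literature.Probability.RandomPlanarGeometry.SAW
open Literature.Probability.Percolation

namespace Literature.Probability.RandomPlanarGeometry.SAW.Zd

namespace WordTypes

variable {m : ℕ}

open Classical in
/-- Filtering the (A, B, ρ) data by a condition on `(A, B)` is the sigma over the filtered base. [cite: MadrasSlade1993, Definition 1.2.4; lane plumbing] -/
private theorem filter_abData_eq_sigma {j p : ℕ} (hp : p + 4 ≤ m) (P : Finset (Fin m) × Finset (Fin m) → Prop) [DecidablePred P] :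
    ((abData m j p hp).filter fun d => P d.1) =
      ((((outerPos m p hp).powerset ×ˢ (outerPos m p hp).powerset).filter fun AB : Finset (Fin m) × Finset (Fin m) => Disjoint AB.1 AB.2).filter P).sigma
        fun AB => twoParts (outerPos m p hp \ (AB.1 ∪ AB.2)) (m - j - 2) := by
  unfold abData; ext d; constructor
  · intro h; rw [Finset.mem_filter, Finset.mem_sigma] at h; exact Finset.mem_sigma.2 ⟨Finset.mem_filter.2 ⟨h.1.1, h.2⟩, h.1.2⟩
  · intro h; rw [Finset.mem_sigma, Finset.mem_filter] at h; exact Finset.mem_filter.2 ⟨Finset.mem_sigma.2 ⟨h.1.1, h.2⟩, h.1.2⟩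

open Classical in
/-- ★★ BOTH OUTER POSITIONS CARRY THE BLOCK AXIS `y`: `#{(A,B,ρ) | o, o' ∈ B} = Σ_{t ≤ m−6} 2^t C(m−6,t) T(m−6−t, m−j−2)`.
[cite: MadrasSlade1993, Definition 1.2.4] [cite: Charalambides2018, Ch. 2 Exercise 32; lane theorem] -/
theorem card_abData_filter_snd_pair_eq_sum {j p : ℕ} (hp : p + 4 ≤ m) {o o' : Fin m} (ho : o ∈ outerPos m p hp) (ho' : o' ∈ outerPos m p hp) (hne : o ≠ o') :
    ((abData m j p hp).filter fun d => o ∈ d.1.2 ∧ o' ∈ d.1.2).card = ∑ t ∈ Finset.range (m - 5), 2 ^ t * (m - 6).choose t * assocStirling (m - 6 - t) (m - j - 2) := by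
  set O := outerPos m p hp with hO
  set D := (O.powerset ×ˢ O.powerset).filter (fun AB : Finset (Fin m) × Finset (Fin m) => Disjoint AB.1 AB.2) with hD
  have hOc : O.card = m - 4 := card_outerPos hp
  have hOge : 2 ≤ O.card := by
    have := Finset.card_le_card (Finset.insert_subset ho (Finset.singleton_subset_iff.2 ho')); rw [Finset.card_pair hne] at this; exact this
  have hmemD : ∀ AB ∈ D, AB.1 ⊆ O ∧ AB.2 ⊆ O ∧ Disjoint AB.1 AB.2 := by
    intro AB hAB
    rw [hD, Finset.mem_filter, Finset.mem_product, Finset.mem_powerset, Finset.mem_powerset] at hAB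
    exact ⟨hAB.1.1, hAB.1.2, hAB.2⟩
  rw [filter_abData_eq_sigma hp (fun AB => o ∈ AB.2 ∧ o' ∈ AB.2), Finset.card_sigma]
  have hval : ∀ AB ∈ D.filter (fun AB => o ∈ AB.2 ∧ o' ∈ AB.2),
      (twoParts (O \ (AB.1 ∪ AB.2)) (m - j - 2)).card = assocStirling (m - 6 - (AB.1.card + AB.2.card - 2)) (m - j - 2) := by
    intro AB hAB
    rw [Finset.mem_filter] at hAB
    obtain ⟨hA, hB, hd⟩ := hmemD AB hAB.1
    have hpos : 2 ≤ AB.2.card := by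
      have := Finset.card_le_card (Finset.insert_subset hAB.2.1 (Finset.singleton_subset_iff.2 hAB.2.2)); rw [Finset.card_pair hne] at this; exact this
    rw [card_twoParts_eq_assocStirling _ _ _ (by rw [Finset.card_sdiff_of_subset (Finset.union_subset hA hB), Finset.card_union_of_disjoint hd, hOc])]
    congr 1; omega
  have hmaps : ∀ AB ∈ D.filter (fun AB => o ∈ AB.2 ∧ o' ∈ AB.2), AB.1.card + AB.2.card - 2 ∈ Finset.range (m - 5) := by
    intro AB hAB
    rw [Finset.mem_filter] at hAB
    obtain ⟨hA, hB, hd⟩ := hmemD AB hAB.1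
    have := Finset.card_le_card (Finset.union_subset hA hB)
    rw [Finset.card_union_of_disjoint hd, hOc] at this
    have hpos : 2 ≤ AB.2.card := by
      have := Finset.card_le_card (Finset.insert_subset hAB.2.1 (Finset.singleton_subset_iff.2 hAB.2.2)); rw [Finset.card_pair hne] at this; exact this
    rw [Finset.mem_range]; omega
  rw [Finset.sum_congr rfl hval, ← Finset.sum_fiberwise_of_maps_to hmaps]
  refine Finset.sum_congr rfl fun t _ => ?_
  rw [Finset.sum_congr rfl (g := fun _ => assocStirling (m - 6 - t) (m - j - 2)) (fun AB hAB => by rw [(Finset.mem_filter.1 hAB).2]), Finset.sum_const, smul_eq_mul]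
  have hfib : ((D.filter fun AB => o ∈ AB.2 ∧ o' ∈ AB.2).filter fun AB => AB.1.card + AB.2.card - 2 = t) =
      ((D.filter fun AB => AB.1.card + AB.2.card = t + 2).filter fun AB => o ∈ AB.2 ∧ o' ∈ AB.2) := by
    ext AB
    simp only [Finset.mem_filter]
    constructor
    · rintro ⟨⟨hABD, hoo⟩, h⟩
      have hpos : 2 ≤ AB.2.card := by
        have := Finset.card_le_card (Finset.insert_subset hoo.1 (Finset.singleton_subset_iff.2 hoo.2)); rw [Finset.card_pair hne] at this; exact this
      exact ⟨⟨hABD, by omega⟩, hoo⟩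
    · rintro ⟨⟨hABD, h⟩, hoo⟩; exact ⟨⟨hABD, hoo⟩, by omega⟩
  have hfc : (((D.filter fun AB => AB.1.card + AB.2.card = t + 2).filter fun AB => o ∈ AB.2 ∧ o' ∈ AB.2)).card = 2 ^ t * (m - 6).choose t := by
    rw [hD, card_disjPairs_filter_pair ho ho' hne t, hOc, show m - 4 - 2 = m - 6 by omega]
  rw [hfib, hfc]

open Classical in
/-- ★★ BOTH OUTER POSITIONS CARRY THE BLOCK AXIS `x`: `#{(A,B,ρ) | o, o' ∈ A} = Σ_{t ≤ m−6} 2^t C(m−6,t) T(m−6−t, m−j−2)`.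
[cite: MadrasSlade1993, Definition 1.2.4] [cite: Charalambides2018, Ch. 2 Exercise 32; lane theorem] -/
theorem card_abData_filter_fst_pair_eq_sum {j p : ℕ} (hp : p + 4 ≤ m) {o o' : Fin m} (ho : o ∈ outerPos m p hp) (ho' : o' ∈ outerPos m p hp) (hne : o ≠ o') :
    ((abData m j p hp).filter fun d => o ∈ d.1.1 ∧ o' ∈ d.1.1).card = ∑ t ∈ Finset.range (m - 5), 2 ^ t * (m - 6).choose t * assocStirling (m - 6 - t) (m - j - 2) := by
  set O := outerPos m p hp with hO
  set D := (O.powerset ×ˢ O.powerset).filter (fun AB : Finset (Fin m) × Finset (Fin m) => Disjoint AB.1 AB.2) with hD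
  have hOc : O.card = m - 4 := card_outerPos hp
  have hmemD : ∀ AB ∈ D, AB.1 ⊆ O ∧ AB.2 ⊆ O ∧ Disjoint AB.1 AB.2 := by
    intro AB hAB
    rw [hD, Finset.mem_filter, Finset.mem_product, Finset.mem_powerset, Finset.mem_powerset] at hAB
    exact ⟨hAB.1.1, hAB.1.2, hAB.2⟩
  rw [filter_abData_eq_sigma hp (fun AB => o ∈ AB.1 ∧ o' ∈ AB.1), Finset.card_sigma]
  have hval : ∀ AB ∈ D.filter (fun AB => o ∈ AB.1 ∧ o' ∈ AB.1),
      (twoParts (O \ (AB.1 ∪ AB.2)) (m - j - 2)).card = assocStirling (m - 6 - (AB.1.card + AB.2.card - 2)) (m - j - 2) := by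
    intro AB hAB
    rw [Finset.mem_filter] at hAB
    obtain ⟨hA, hB, hd⟩ := hmemD AB hAB.1
    have hpos : 2 ≤ AB.1.card := by
      have := Finset.card_le_card (Finset.insert_subset hAB.2.1 (Finset.singleton_subset_iff.2 hAB.2.2)); rw [Finset.card_pair hne] at this; exact this
    rw [card_twoParts_eq_assocStirling _ _ _ (by rw [Finset.card_sdiff_of_subset (Finset.union_subset hA hB), Finset.card_union_of_disjoint hd, hOc])]
    congr 1; omega
  have hmaps : ∀ AB ∈ D.filter (fun AB => o ∈ AB.1 ∧ o' ∈ AB.1), AB.1.card + AB.2.card - 2 ∈ Finset.range (m - 5) := by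
    intro AB hAB
    rw [Finset.mem_filter] at hAB
    obtain ⟨hA, hB, hd⟩ := hmemD AB hAB.1
    have := Finset.card_le_card (Finset.union_subset hA hB)
    rw [Finset.card_union_of_disjoint hd, hOc] at this
    have hpos : 2 ≤ AB.1.card := by
      have := Finset.card_le_card (Finset.insert_subset hAB.2.1 (Finset.singleton_subset_iff.2 hAB.2.2)); rw [Finset.card_pair hne] at this; exact this
    rw [Finset.mem_range]; omega
  rw [Finset.sum_congr rfl hval, ← Finset.sum_fiberwise_of_maps_to hmaps]
  refine Finset.sum_congr rfl fun t _ => ?_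
  rw [Finset.sum_congr rfl (g := fun _ => assocStirling (m - 6 - t) (m - j - 2)) (fun AB hAB => by rw [(Finset.mem_filter.1 hAB).2]), Finset.sum_const, smul_eq_mul]
  have hfib : ((D.filter fun AB => o ∈ AB.1 ∧ o' ∈ AB.1).filter fun AB => AB.1.card + AB.2.card - 2 = t) =
      ((D.filter fun AB => AB.1.card + AB.2.card = t + 2).filter fun AB => o ∈ AB.1 ∧ o' ∈ AB.1) := by
    ext AB
    simp only [Finset.mem_filter]
    constructor
    · rintro ⟨⟨hABD, hoo⟩, h⟩
      have hpos : 2 ≤ AB.1.card := by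
        have := Finset.card_le_card (Finset.insert_subset hoo.1 (Finset.singleton_subset_iff.2 hoo.2)); rw [Finset.card_pair hne] at this; exact this
      exact ⟨⟨hABD, by omega⟩, hoo⟩
    · rintro ⟨⟨hABD, h⟩, hoo⟩; exact ⟨⟨hABD, hoo⟩, by omega⟩
  have hfc : (((D.filter fun AB => AB.1.card + AB.2.card = t + 2).filter fun AB => o ∈ AB.1 ∧ o' ∈ AB.1)).card = 2 ^ t * (m - 6).choose t := by
    rw [hD, card_disjPairs_filter_pair_fst ho ho' hne t, hOc, show m - 4 - 2 = m - 6 by omega]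
  rw [hfib, hfc]

open Classical in
/-- ★★ BOTH OUTER POSITIONS IN ONE BLOCK OF `ρ`: `#{(A,B,ρ) | ∃ C ∈ ρ, o, o' ∈ C} = Σ_{t ≤ m−6} 2^t C(m−6,t) S(m−4−t, m−j−2)` — `(A, B)` must avoid
`o, o'` (the blocks of `ρ`
partition `O ∖ (A ∪ B)`), and then `S` counts the partitions with `o, o'` together. [cite: MadrasSlade1993, Definition 1.2.4] [cite: Charalambides2018, Ch. 2 Exercise 32; lane theorem] -/
theorem card_abData_filter_sameRho_eq_sum {j p : ℕ} (hp : p + 4 ≤ m) {o o' : Fin m} (ho : o ∈ outerPos m p hp) (ho' : o' ∈ outerPos m p hp) (hne : o ≠ o') :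
    ((abData m j p hp).filter fun d => ∃ C ∈ d.2, o ∈ C ∧ o' ∈ C).card = ∑ t ∈ Finset.range (m - 5), 2 ^ t * (m - 6).choose t * sameBlockT (m - 4 - t) (m - j - 2) := by
  set O := outerPos m p hp with hO
  set k := m - j - 2 with hk
  set D := (O.powerset ×ˢ O.powerset).filter (fun AB : Finset (Fin m) × Finset (Fin m) => Disjoint AB.1 AB.2) with hD
  have hOc : O.card = m - 4 := card_outerPos hp
  have hmemD : ∀ AB ∈ D, AB.1 ⊆ O ∧ AB.2 ⊆ O ∧ Disjoint AB.1 AB.2 := by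
    intro AB hAB
    rw [hD, Finset.mem_filter, Finset.mem_product, Finset.mem_powerset, Finset.mem_powerset] at hAB
    exact ⟨hAB.1.1, hAB.1.2, hAB.2⟩
  -- the filter lives on the fibres
  have hsig : ((abData m j p hp).filter fun d => ∃ C ∈ d.2, o ∈ C ∧ o' ∈ C) =
      D.sigma fun AB => (twoParts (O \ (AB.1 ∪ AB.2)) k).filter fun ρ => ∃ C ∈ ρ, o ∈ C ∧ o' ∈ C := by
    unfold abData; ext d
    simp only [Finset.mem_filter, Finset.mem_sigma, hD]
    tauto
  rw [hsig, Finset.card_sigma]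
  -- fibres over `(A, B)` meeting `o` or `o'` are empty; over the avoiding ones they are the `blockOf` filter
  have hval : ∀ AB ∈ D, ((twoParts (O \ (AB.1 ∪ AB.2)) k).filter fun ρ => ∃ C ∈ ρ, o ∈ C ∧ o' ∈ C).card =
      if o ∉ AB.1 ∪ AB.2 ∧ o' ∉ AB.1 ∪ AB.2 then sameBlockT (m - 4 - (AB.1.card + AB.2.card)) k else 0 := by
    intro AB hAB
    obtain ⟨hA, hB, hd⟩ := hmemD AB hAB
    split_ifs with hav
    · have hoR : o ∈ O \ (AB.1 ∪ AB.2) := Finset.mem_sdiff.2 ⟨ho, hav.1⟩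
      have ho'R : o' ∈ O \ (AB.1 ∪ AB.2) := Finset.mem_sdiff.2 ⟨ho', hav.2⟩
      have hRc : (O \ (AB.1 ∪ AB.2)).card = m - 4 - (AB.1.card + AB.2.card) := by
        rw [Finset.card_sdiff_of_subset (Finset.union_subset hA hB), Finset.card_union_of_disjoint hd, hOc]
      rw [← hRc, ← card_twoParts_filter_mem_blockOf_eq hoR ho'R hne k]
      congr 1; ext ρ; simp only [Finset.mem_filter]
      constructor
      · rintro ⟨hρ, C, hC, hoC, ho'C⟩
        exact ⟨hρ, by rw [(mem_twoParts.1 hρ).1.eq_blockOf hC hoC]; exact ho'C⟩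
      · rintro ⟨hρ, h⟩
        have hpart := (mem_twoParts.1 hρ).1
        exact ⟨hρ, blockOf ρ o, hpart.blockOf_mem hoR, hpart.mem_blockOf hoR, h⟩
    · rw [Finset.card_eq_zero, Finset.filter_eq_empty_iff]
      rintro ρ hρ ⟨C, hC, hoC, ho'C⟩
      have hsub := (mem_twoParts.1 hρ).1.subset hC
      have h1 := Finset.mem_sdiff.1 (hsub hoC)
      have h2 := Finset.mem_sdiff.1 (hsub ho'C)
      exact hav ⟨h1.2, h2.2⟩
  rw [Finset.sum_congr rfl hval, ← Finset.sum_filter, hD, disjPairs_filter_avoid O o o']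
  -- now a sum over the disjoint pairs of `O ∖ {o, o'}` by total size
  set O' := O \ {o, o'} with hO'
  have hOge : 2 ≤ O.card := by
    have := Finset.card_le_card (Finset.insert_subset ho (Finset.singleton_subset_iff.2 ho')); rw [Finset.card_pair hne] at this; exact this
  have hO'c : O'.card = m - 6 := by
    rw [hO', Finset.card_sdiff_of_subset (Finset.insert_subset ho (Finset.singleton_subset_iff.2 ho')), Finset.card_pair hne, hOc]; omega
  set D' := (O'.powerset ×ˢ O'.powerset).filter (fun AB : Finset (Fin m) × Finset (Fin m) => Disjoint AB.1 AB.2) with hD'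
  have hmemD' : ∀ AB ∈ D', AB.1 ⊆ O' ∧ AB.2 ⊆ O' ∧ Disjoint AB.1 AB.2 := by
    intro AB hAB
    rw [hD', Finset.mem_filter, Finset.mem_product, Finset.mem_powerset, Finset.mem_powerset] at hAB
    exact ⟨hAB.1.1, hAB.1.2, hAB.2⟩
  have hmaps : ∀ AB ∈ D', AB.1.card + AB.2.card ∈ Finset.range (m - 5) := by
    intro AB hAB
    obtain ⟨hA, hB, hd⟩ := hmemD' AB hAB
    have := Finset.card_le_card (Finset.union_subset hA hB)
    rw [Finset.card_union_of_disjoint hd, hO'c] at this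
    rw [hOc] at hOge
    rw [Finset.mem_range]; omega
  rw [← Finset.sum_fiberwise_of_maps_to hmaps]
  refine Finset.sum_congr rfl fun t _ => ?_
  rw [Finset.sum_congr rfl (g := fun _ => sameBlockT (m - 4 - t) k) (fun AB hAB => by rw [(Finset.mem_filter.1 hAB).2]), Finset.sum_const, smul_eq_mul, hD',
    card_disjPairs_eq O' t, hO'c]

open Classical in
/-- ★★★ TWO OUTER POSITIONS IN ONE BLOCK, FOR EVERY LAYER (`N_same` of FINDING §21 (v)):
`#{(A,B,ρ) ∈ abData(m,j,p) | o, o' ∈ A ∨ o, o' ∈ B ∨ o, o' in one block of ρ} = Σ_{t ≤ m−6} 2^t C(m−6,t)·(2·T(m−6−t,k) + S(m−4−t,k))`, `k = m − j − 2`.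
[cite: MadrasSlade1993, Definition 1.2.4] [cite: Charalambides2018, Ch. 2 Exercise 32; lane theorem] -/
theorem card_abData_filter_same_eq_sum {j p : ℕ} (hp : p + 4 ≤ m) {o o' : Fin m} (ho : o ∈ outerPos m p hp) (ho' : o' ∈ outerPos m p hp) (hne : o ≠ o') :
    ((abData m j p hp).filter fun d => (o ∈ d.1.1 ∧ o' ∈ d.1.1) ∨ (o ∈ d.1.2 ∧ o' ∈ d.1.2) ∨ ∃ C ∈ d.2, o ∈ C ∧ o' ∈ C).card =
      ∑ t ∈ Finset.range (m - 5), 2 ^ t * (m - 6).choose t * (2 * assocStirling (m - 6 - t) (m - j - 2) + sameBlockT (m - 4 - t) (m - j - 2)) := by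
  have habD : ∀ d ∈ abData m j p hp, Disjoint d.1.1 d.1.2 ∧ d.2 ∈ twoParts (outerPos m p hp \ (d.1.1 ∪ d.1.2)) (m - j - 2) := by
    intro d hd; unfold abData at hd; rw [Finset.mem_sigma, Finset.mem_filter] at hd; exact ⟨hd.1.2, hd.2⟩
  have hexAB : ∀ d ∈ abData m j p hp, o ∈ d.1.1 → o ∉ d.1.2 := fun d hd hoA hoB => Finset.disjoint_left.1 (habD d hd).1 hoA hoB
  have hexR : ∀ d ∈ abData m j p hp, ∀ C ∈ d.2, o ∈ C → o ∉ d.1.1 ∧ o ∉ d.1.2 := by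
    intro d hd C hC hoC
    have hsub := (mem_twoParts.1 (habD d hd).2).1.subset hC hoC
    rw [Finset.mem_sdiff, Finset.mem_union, not_or] at hsub
    exact hsub.2
  rw [Finset.filter_or, Finset.filter_or, Finset.card_union_of_disjoint, Finset.card_union_of_disjoint, card_abData_filter_fst_pair_eq_sum hp ho ho' hne,
    card_abData_filter_snd_pair_eq_sum hp ho ho' hne, card_abData_filter_sameRho_eq_sum hp ho ho' hne, ← Finset.sum_add_distrib, ← Finset.sum_add_distrib]
  · exact Finset.sum_congr rfl fun t _ => by ring
  · rw [Finset.disjoint_left]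
    intro d h1 h2
    rw [Finset.mem_filter] at h1 h2
    obtain ⟨C, hC, hoC, -⟩ := h2.2
    exact (hexR d h2.1 C hC hoC).2 h1.2.1
  · rw [Finset.disjoint_left]
    intro d h1 h2
    rw [Finset.mem_filter] at h1
    rcases Finset.mem_union.1 h2 with h2 | h2 <;> rw [Finset.mem_filter] at h2
    · exact hexAB d h1.1 h1.2.1 h2.2.1
    · obtain ⟨C, hC, hoC, -⟩ := h2.2
      exact (hexR d h2.1 C hC hoC).1 h1.2.1

/-- At `m = 2j − 1` (`2j − 5` outer positions, `k = j − 3`… i.e. `m − j − 2`) the count is car M's `K_j = C(2j−7,3)(2j−11)‼ + 3(2j−7)(2j−9)‼`: `3,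
10, 55, 420` for `j = 4…7`. [cite: MadrasSlade1993, Definition 1.2.4; lane theorem] -/
theorem card_abData_filter_same_values :
    (∑ t ∈ Finset.range (2 * 4 - 1 - 5), 2 ^ t * (2 * 4 - 1 - 6).choose t * (2 * assocStirling (2 * 4 - 1 - 6 - t) (2 * 4 - 1 - 4 - 2) + sameBlockT (2 * 4 - 1 - 4 - t) (2 * 4 - 1 - 4 - 2))
        = 3) ∧
    (∑ t ∈ Finset.range (2 * 5 - 1 - 5), 2 ^ t * (2 * 5 - 1 - 6).choose t * (2 * assocStirling (2 * 5 - 1 - 6 - t) (2 * 5 - 1 - 5 - 2) + sameBlockT (2 * 5 - 1 - 4 - t) (2 * 5 - 1 - 5 - 2))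
        = 10) ∧
    (∑ t ∈ Finset.range (2 * 6 - 1 - 5), 2 ^ t * (2 * 6 - 1 - 6).choose t * (2 * assocStirling (2 * 6 - 1 - 6 - t) (2 * 6 - 1 - 6 - 2) + sameBlockT (2 * 6 - 1 - 4 - t) (2 * 6 - 1 - 6 - 2))
        = 55) ∧
    (∑ t ∈ Finset.range (2 * 7 - 1 - 5), 2 ^ t * (2 * 7 - 1 - 6).choose t * (2 * assocStirling (2 * 7 - 1 - 6 - t) (2 * 7 - 1 - 7 - 2) + sameBlockT (2 * 7 - 1 - 4 - t) (2 * 7 - 1 - 7 - 2))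
        = 420) := by
  refine ⟨by decide, by decide, by decide, by decide⟩

end WordTypes

end Literature.Probability.RandomPlanarGeometry.SAW.Zd
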